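import Summits.Ventures.DiscreteObjects.PP12.FlagTenFibres
import Summits.Ventures.DiscreteObjects.PP12.FlagTenCSeparates

/-!
# The `f = 10` flag-cell orbit data: equation (C4) at subtype level (kernel; Step D, conjunct 10 of `IsFlagTenOrbitMatrix` before transport)
Framing: lottery ticket; floor = certified bounds/negative ranges.

Cell pub-namedobj (venture DiscreteObjects), target (M), designs gen 13 (HOME FAMILY-FLAG7X §7b). Setting as in `FlagTenOrbitDataOfPlane`.
For two fixed lines `m ≠ m'` (both `≠ l`) and non-fixed points `w ∈ m`, `w' ∈ m'` (representing the orbits `orb3 w`, `orb3 w'`):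
`#{x ∈ u₀, x ≠ c : gammaOrb m x = orb3 w ∧ gammaOrb m' x = orb3 w'} + #{y fixed, y ≠ c : betaOrb m' (orb3 (w·y)) = orb3 w'} = 3`
(**`tpoint_pair_count`**) — the plane-level identity `OrbitSideIdentities.flag_tpoints_common_orbits` with the common line orbits through `w` sorted into
side orbits (↔ vertices on `u₀`) and T-line orbits (↔ fixed points `y ≠ c`, the line `w·y`). This is conjunct 10,
`#{i : γ j i = t ∧ γ j' i = t'} + #{(k,s) : β k j s = t ∧ β k j' s = t'} = 3`, before transport (for `(k,s)` with `β k j s = t` the orbit `s` is the one of `w·y_k`).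
Helper: `gammaOrb_eq_iff` (`gammaOrb m x = orb3 w` iff a line of the side orbit of `x` passes through `w`). No `sorry`, no new axioms.
-/

namespace Summit.Ventures.DiscreteObjects.PP12

open Configuration Finset
open scoped Classical

namespace Collineation

variable {P L : Type*} [Membership P L] [ProjectivePlane P L] [Fintype P] [Fintype L] (σ : Collineation P L)

section Flag

variable {l : L} {c : P} (hl : σ.onLines l = l) (hc : σ.onPoints c = c) (hcl : c ∈ l)
  (hP : ∀ p : P, σ.onPoints p = p → p ∈ l) (hL : ∀ m : L, σ.onLines m = m → c ∈ m)
  (h12 : ProjectivePlane.order P L = 12)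

include hl hc hP hL in
/-- `gammaOrb m x = orb3 w` (for `w ∈ m`, `m` fixed, `x` exterior) iff some line of the side orbit of `x` passes through `w`. -/
theorem gammaOrb_eq_iff (hq : σ.onPoints ^ 3 = 1) {x : P} (hxX : ∀ m : L, σ.onLines m = m → x ∉ m) {m : L} (hm : σ.onLines m = m)
    {w : P} (hwm : w ∈ m) : σ.gammaOrb l c m x = orb3 σ.onPoints w ↔ ∃ a' ∈ orb3 σ.onLines (σ.sideOf l x), w ∈ a' := by
  have hxf : σ.onPoints x ≠ x := σ.not_fixed_of_exterior_flag hl hP hxX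
  obtain ⟨hxa, hσxa⟩ := σ.sideOf_spec l hxf
  obtain ⟨-, ha0⟩ := σ.side_no_fixed_point hxf hxX hxa hσxa
  have ham : σ.sideOf l x ≠ m := fun e => ha0 c hc (e ▸ hL m hm)
  have hcx : c ∉ σ.sideOf l x := fun h => ha0 c hc h
  obtain ⟨-, -, -, hwf⟩ := σ.gammaOrb_mem hl hc hP hL hxX hm
  change orb3 σ.onPoints (meetPt c (σ.sideOf l x) m) = orb3 σ.onPoints w ↔ _
  constructor
  · intro h
    have hw : w ∈ orb3 σ.onPoints (meetPt c (σ.sideOf l x) m) := by rw [h]; exact self_mem_orb3 _ _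
    exact (σ.side_orbit_line_through (c := c) hq hm ham hwf hw).1
  · rintro ⟨a', ha', hwa'⟩
    have ha'm : a' ≠ m := fun e => (σ.orb3_side_noFixed ha0 ha') c hc (e ▸ hL m hm)
    have h1 := σ.betaOrb_eq hc hL hq hm hcx ha'
    rw [σ.betaOrb_eq hc hL hq hm hcx (self_mem_orb3 _ _)] at h1
    rw [h1, ← meetPt_eq c ha'm hwa' hwm]

omit [Fintype P] [Fintype L] in
/-- A line of the side orbit of `x` carries two consecutive points of the orbit of `x` (it is a side of that triangle). -/
theorem side_of_mem_orb3_sideOf (hq : σ.onPoints ^ 3 = 1) {x : P} (hxf : σ.onPoints x ≠ x) {a' : L} (ha' : a' ∈ orb3 σ.onLines (σ.sideOf l x)) :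
    ∃ Q ∈ orb3 σ.onPoints x, Q ∈ a' ∧ σ.onPoints Q ∈ a' := by
  obtain ⟨hxa, hσxa⟩ := σ.sideOf_spec l hxf
  have h3 := apply_three σ.onPoints hq x
  rw [mem_orb3] at ha'
  rcases ha' with rfl | rfl | rfl
  · exact ⟨x, self_mem_orb3 _ _, hxa, hσxa⟩
  · exact ⟨σ.onPoints x, (mem_orb3 _ _ _).2 (Or.inr (Or.inl rfl)), σ.mem_map hxa, σ.mem_map hσxa⟩
  · refine ⟨σ.onPoints (σ.onPoints x), (mem_orb3 _ _ _).2 (Or.inr (Or.inr rfl)), σ.mem_map (σ.mem_map hxa), ?_⟩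
    rw [h3]; have := σ.mem_map (σ.mem_map hσxa); rwa [h3] at this

include hl hc hcl hP hL h12 in
/-- **(C4) at subtype level** (`f = 10`): see the module docstring. -/
theorem tpoint_pair_count (hq : σ.onPoints ^ 3 = 1) (hf : fixedCard σ.onPoints = 10) {u₀ : L} (hcu₀ : c ∈ u₀) (hu₀ : σ.onLines u₀ ≠ u₀)
    {m m' : L} (hm : σ.onLines m = m) (hml : m ≠ l) (hm' : σ.onLines m' = m') (hm'l : m' ≠ l) (hmm' : m ≠ m')
    {w w' : P} (hwm : w ∈ m) (hwc : w ≠ c) (hwf : σ.onPoints w ≠ w) (hw'm' : w' ∈ m') (hw'c : w' ≠ c) :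
    (univ.filter fun x : P => x ∈ u₀ ∧ x ≠ c ∧ σ.gammaOrb l c m x = orb3 σ.onPoints w ∧ σ.gammaOrb l c m' x = orb3 σ.onPoints w').card
      + (univ.filter fun y : P => σ.onPoints y = y ∧ y ≠ c ∧
          σ.betaOrb c m' (orb3 σ.onLines (lineThrough l w y)) = orb3 σ.onPoints w').card = 3 := by
  have hqL : σ.onLines ^ 3 = 1 := σ.onLines_pow_eq_one hq
  have h3 := σ.flag_tpoints_common_orbits hq hcl hP hL hm hm' hmm' hml hm'l hwm hwc hw'm' hw'c
  set S : Finset L := univ.filter fun e : L => w ∈ e ∧ σ.onLines e ≠ e ∧ ∃ e' ∈ orb3 σ.onLines e, w' ∈ e' with hS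
  rw [← h3, ← Finset.card_filter_add_card_filter_not (s := S) (fun e : L => ∀ p : P, σ.onPoints p = p → p ∉ e)]
  have hwl : w ∉ l := fun h => hwc ((Nondegenerate.eq_or_eq hwm (hL m hm) h hcl).resolve_right hml)
  -- at most one line of any line orbit through w (w is a non-fixed point on the fixed line m)
  have hw1 : ∀ a : L, ((orb3 σ.onLines a).filter fun a' => w ∈ a').card ≤ 1 := fun a =>
    σ.dual.card_orb3_inter_le_one_of_fixed_mem (a := (w : Dual P)) (y := (m : Dual L)) hqL hwf hm hwm a
  congr 1
  · -- exterior lines through w ↔ vertices x with both γ-conditions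
    set F : Finset P := univ.filter fun x : P => x ∈ u₀ ∧ x ≠ c ∧ σ.gammaOrb l c m x = orb3 σ.onPoints w ∧
        σ.gammaOrb l c m' x = orb3 σ.onPoints w' with hF
    let Φ : P → L := fun x => if h : ((orb3 σ.onLines (σ.sideOf l x)).filter fun a' => w ∈ a').Nonempty then h.choose else l
    have memF : ∀ x ∈ F, (∀ m₁ : L, σ.onLines m₁ = m₁ → x ∉ m₁) ∧ x ∈ u₀ ∧ (∃ a' ∈ orb3 σ.onLines (σ.sideOf l x), w ∈ a') ∧
        ∃ a'' ∈ orb3 σ.onLines (σ.sideOf l x), w' ∈ a'' := by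
      intro x hx; rw [hF, mem_filter] at hx
      obtain ⟨-, hxu, hxc, hγ, hγ'⟩ := hx
      have hxX := σ.exterior_of_mem_cline hL hcu₀ hu₀ hxu hxc
      exact ⟨hxX, hxu, (σ.gammaOrb_eq_iff hl hc hP hL hq hxX hm hwm).1 hγ, (σ.gammaOrb_eq_iff hl hc hP hL hq hxX hm' hw'm').1 hγ'⟩
    have hΦ : ∀ x ∈ F, Φ x ∈ orb3 σ.onLines (σ.sideOf l x) ∧ w ∈ Φ x := by
      intro x hx
      obtain ⟨-, -, ⟨a', ha', hwa'⟩, -⟩ := memF x hx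
      have hne : ((orb3 σ.onLines (σ.sideOf l x)).filter fun a' => w ∈ a').Nonempty := ⟨a', mem_filter.2 ⟨ha', hwa'⟩⟩
      have : Φ x = hne.choose := by simp only [Φ, dif_pos hne]
      rw [this]; exact mem_filter.1 hne.choose_spec
    refine Finset.card_bij (fun x _ => Φ x) (fun x hx => ?_) (fun x₁ hx₁ x₂ hx₂ heq => ?_) (fun e he => ?_)
    · obtain ⟨hxX, -, -, ⟨a'', ha'', hw'a''⟩⟩ := memF x hx
      obtain ⟨hΦo, hwΦ⟩ := hΦ x hx
      have hxf : σ.onPoints x ≠ x := σ.not_fixed_of_exterior_flag hl hP hxX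
      obtain ⟨hxa, hσxa⟩ := σ.sideOf_spec l hxf
      have ha0 := (σ.side_no_fixed_point hxf hxX hxa hσxa).2
      have hΦ0 := σ.orb3_side_noFixed ha0 hΦo
      rw [mem_filter, hS, mem_filter]
      refine ⟨⟨mem_univ _, hwΦ, fun e => hΦ0 c hc (hL (Φ x) e), a'', ?_, hw'a''⟩, hΦ0⟩
      rw [orb3_eq_of_mem σ.onLines hqL hΦo]; exact ha''
    · -- injective: a common line of two side orbits is a side of both triangles
      obtain ⟨hx₁X, h₁u, -, -⟩ := memF x₁ hx₁
      obtain ⟨hx₂X, h₂u, -, -⟩ := memF x₂ hx₂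
      have h₁f : σ.onPoints x₁ ≠ x₁ := σ.not_fixed_of_exterior_flag hl hP hx₁X
      have h₂f : σ.onPoints x₂ ≠ x₂ := σ.not_fixed_of_exterior_flag hl hP hx₂X
      obtain ⟨Q₁, hQ₁, hQ₁a, hσQ₁a⟩ := σ.side_of_mem_orb3_sideOf (l := l) hq h₁f (hΦ x₁ hx₁).1
      obtain ⟨Q₂, hQ₂, hQ₂a, hσQ₂a⟩ := σ.side_of_mem_orb3_sideOf (l := l) hq h₂f (hΦ x₂ hx₂).1
      rw [← heq] at hQ₂a hσQ₂a
      have hQ₁X := σ.exterior_of_mem_orb3 hx₁X hQ₁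
      have hQQ : Q₂ = Q₁ := σ.side_unique hQ₁X hQ₁a hσQ₁a hQ₂a hσQ₂a
      have horb : orb3 σ.onPoints x₂ = orb3 σ.onPoints x₁ := by
        rw [← orb3_eq_of_mem σ.onPoints hq hQ₂, hQQ, orb3_eq_of_mem σ.onPoints hq hQ₁]
      have hx₂o : x₂ ∈ orb3 σ.onPoints x₁ := by rw [← horb]; exact self_mem_orb3 _ _
      have hle := σ.card_orb3_inter_cline_le_one hc hq hcu₀ hu₀ x₁
      by_contra hne
      have h2 : 2 ≤ ((orb3 σ.onPoints x₁).filter fun q => q ∈ u₀).card := by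
        have hsub : ({x₁, x₂} : Finset P) ⊆ (orb3 σ.onPoints x₁).filter fun q => q ∈ u₀ := by
          intro z hz; rw [mem_insert, mem_singleton] at hz; rw [mem_filter]
          rcases hz with rfl | rfl
          · exact ⟨self_mem_orb3 _ _, h₁u⟩
          · exact ⟨hx₂o, h₂u⟩
        have := card_le_card hsub; rwa [card_pair hne] at this
      omega
    · -- surjective
      rw [mem_filter, hS, mem_filter] at he
      obtain ⟨⟨-, hwe, hne, a'', ha'', hw'a''⟩, he0⟩ := he
      obtain ⟨Q, hQ, hQe, hσQe⟩ := σ.exterior_line_is_side hl hc hcl hP hL hne he0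
      obtain ⟨x, hxQ, hxu⟩ := σ.exterior_orbit_meets_cline hl hc hcl hL h12 hq hf hcu₀ hu₀ hQ.2
      have hxX := σ.exterior_of_mem_orb3 hQ.2 hxQ
      have hxc : x ≠ c := fun e => hxX l hl (e ▸ hcl)
      have hxf : σ.onPoints x ≠ x := σ.not_fixed_of_exterior_flag hl hP hxX
      have hQx : Q ∈ orb3 σ.onPoints x := by rw [orb3_eq_of_mem σ.onPoints hq hxQ]; exact self_mem_orb3 _ _
      have heo : e ∈ orb3 σ.onLines (σ.sideOf l x) := σ.mem_orb3_sideOf_of_side hq hxf hQx hQ.1 hQe hσQe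
      have hoe : orb3 σ.onLines e = orb3 σ.onLines (σ.sideOf l x) := orb3_eq_of_mem σ.onLines hqL heo
      have hxF : x ∈ F := by
        rw [hF, mem_filter]
        refine ⟨mem_univ _, hxu, hxc, (σ.gammaOrb_eq_iff hl hc hP hL hq hxX hm hwm).2 ⟨e, heo, hwe⟩,
          (σ.gammaOrb_eq_iff hl hc hP hL hq hxX hm' hw'm').2 ⟨a'', by rw [← hoe]; exact ha'', hw'a''⟩⟩
      refine ⟨x, hxF, ?_⟩
      obtain ⟨hΦo, hwΦ⟩ := hΦ x hxF
      by_contra hne'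
      have h2 : 2 ≤ ((orb3 σ.onLines (σ.sideOf l x)).filter fun a' => w ∈ a').card := by
        have hsub : ({Φ x, e} : Finset L) ⊆ (orb3 σ.onLines (σ.sideOf l x)).filter fun a' => w ∈ a' := by
          intro z hz; rw [mem_insert, mem_singleton] at hz; rw [mem_filter]
          rcases hz with rfl | rfl
          · exact ⟨hΦo, hwΦ⟩
          · exact ⟨heo, hwe⟩
        have := card_le_card hsub; rwa [card_pair hne'] at this
      have := hw1 (σ.sideOf l x); omega
  · -- lines through w with a fixed point ↔ fixed points y ≠ c (the line w·y) with the β-condition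
    set G : Finset P := univ.filter fun y : P => σ.onPoints y = y ∧ y ≠ c ∧
        σ.betaOrb c m' (orb3 σ.onLines (lineThrough l w y)) = orb3 σ.onPoints w' with hG
    have hwy : ∀ {y : P}, σ.onPoints y = y → w ≠ y := fun hy e => hwf (by rw [e, hy])
    refine Finset.card_bij (fun y _ => lineThrough l w y) (fun y hy => ?_) (fun y₁ hy₁ y₂ hy₂ heq => ?_) (fun e he => ?_)
    · rw [hG, mem_filter] at hy
      obtain ⟨-, hy, hyc, hβ⟩ := hy
      obtain ⟨hwk, hyk⟩ := lineThrough_spec l (hwy hy)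
      set k := lineThrough l w y with hk
      have hkl : k ≠ l := fun e => hwl (e ▸ hwk)
      have hkf : σ.onLines k ≠ k := σ.tline_not_fixed hcl hP hL hy hyc hyk hkl
      have hck : c ∉ k := σ.c_not_mem_tline hcl hP hy hyc hyk hkl
      have hkm' : k ≠ m' := fun e => hck (e ▸ hL m' hm')
      obtain ⟨v, hvk, hvm', hvf, -, hvuniq⟩ := σ.tline_inter_fixedLine hcl hP hL hy hyc hyk hkl hm' hm'l
      have hv : meetPt c k m' = v := hvuniq _ (meetPt_spec c hkm').1 (meetPt_spec c hkm').2
      rw [σ.betaOrb_eq hc hL hq hm' hck (self_mem_orb3 _ _), hv] at hβ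
      have hw'o : w' ∈ orb3 σ.onPoints (meetPt c k m') := by rw [hv, hβ]; exact self_mem_orb3 _ _
      have hvf' : σ.onPoints (meetPt c k m') ≠ meetPt c k m' := by rw [hv]; exact hvf
      obtain ⟨⟨e', he', hw'e'⟩, -⟩ := σ.side_orbit_line_through (c := c) hq hm' hkm' hvf' hw'o
      rw [mem_filter, hS, mem_filter]
      exact ⟨⟨mem_univ _, hwk, hkf, e', he', hw'e'⟩, fun h => h y hy hyk⟩
    · rw [hG, mem_filter] at hy₁ hy₂
      obtain ⟨hwk₁, hyk₁⟩ := lineThrough_spec l (hwy hy₁.2.1)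
      obtain ⟨-, hyk₂⟩ := lineThrough_spec l (hwy hy₂.2.1)
      rw [← heq] at hyk₂
      have hkl : lineThrough l w y₁ ≠ l := fun e => hwl (e ▸ hwk₁)
      exact (Nondegenerate.eq_or_eq hyk₁ hyk₂ (hP y₁ hy₁.2.1) (hP y₂ hy₂.2.1)).resolve_right hkl
    · rw [mem_filter, hS, mem_filter] at he
      obtain ⟨⟨-, hwe, hne, e', he', hw'e'⟩, he0⟩ := he
      push Not at he0
      obtain ⟨y, hy, hye⟩ := he0
      have hyc : y ≠ c := by
        intro e1; rw [e1] at hye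
        exact hne (((Nondegenerate.eq_or_eq hwe hye hwm (hL m hm)).resolve_left hwc) ▸ hm)
      have hk : lineThrough l w y = e :=
        ((Nondegenerate.eq_or_eq (lineThrough_spec l (hwy hy)).1 (lineThrough_spec l (hwy hy)).2 hwe hye).resolve_left (hwy hy))
      refine ⟨y, ?_, hk⟩
      rw [hG, mem_filter]
      refine ⟨mem_univ _, hy, hyc, ?_⟩
      rw [hk]
      have hel : e ≠ l := fun e1 => hwl (e1 ▸ hwe)
      have hce : c ∉ e := σ.c_not_mem_tline hcl hP hy hyc hye hel
      have hem' : e ≠ m' := fun e1 => hce (e1 ▸ hL m' hm')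
      rw [σ.betaOrb_eq hc hL hq hm' hce he']
      -- e' passes through y (y is fixed), hence e' ≠ m'; and w' = e' ∩ m'
      have hyσ : ∀ g : L, y ∈ g → y ∈ σ.onLines g := fun g hg => by have := σ.mem_map hg; rwa [hy] at this
      have hye' : y ∈ e' := by
        rw [mem_orb3] at he'
        rcases he' with e1 | e1 | e1
        · rw [e1]; exact hye
        · rw [e1]; exact hyσ _ hye
        · rw [e1]; exact hyσ _ (hyσ _ hye)
      have he'm' : e' ≠ m' := fun e1 => hm'l ((Nondegenerate.eq_or_eq (e1 ▸ hye') (hL m' hm') (hP y hy) hcl).resolve_left hyc)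
      rw [← meetPt_eq c he'm' hw'e' hw'm']

end Flag

end Collineation

end Summit.Ventures.DiscreteObjects.PP12
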